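import Summits.NavierStokesRegularity.NavierStokesRegularity.Theorems.TypeIIInviscidRelaxationAxisymSwirlRegularInflowCriticalFloor
import Summits.NavierStokesRegularity.NavierStokesRegularity.Theorems.ScenarioCensusRowF5lg
import HarnessLib

/-!
# Crux `AxisymSwirlRegular` (stmt-NavierStokesRegularity-1964), line `radial_inflow_split`:
# a one-wall inflow + pressure-excess continuation criterion (rung below X₁ ∧ X₂)

`--supports stmt-NavierStokesRegularity-1964` (helper file; theorems only, no definitions).

Composition of the radial-momentum minimum principle (`…InflowMinPrinciple.lean`, `…InflowCriticalFloor.lean`)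
with the tree's subcritical one-sided radial criterion `ScenarioCensus.LogGate.oneSidedRadialCriterion_of_lt_two`
(`r u_r ≥ −Cν` near the axis with `C < 2` ⟹ extension; Wei 2016 via the log gate): the minimum principle
delivers `r u_r ≥ −(L + I)` on an axis tube from (i) `r u_r ≥ −L` on ONE cylinder wall `{r = δ₁}`, far away and
initially, and (ii) a floor `−g(t)`, `∫g ≤ I`, for the cyclostrophic defect `u_r² + u_θ² − r∂ᵣp` at the
strongest-inflow points; so `L + I < 2ν` continues the solution past `T`
(`hasSmoothExtensionPast_of_wallInflow_of_criticalDefectFloor`). Contrapositive: an axisymmetric blow-up at `T`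
needs, on every thin tube, either wall/far/initial inflow below `−L` or a cumulative pressure-pull excess
`≥ 2ν − L` at the strongest-inflow points. No route item is closed; NS regularity is not touched.

* `radialMomentum_minPrinciple_engine_wall` — the engine with boundary data on `Φ` itself;
* `hasSmoothExtensionPast_of_wallInflow_of_criticalDefectFloor` — the criterion.
-/

noncomputable section

open Literature.Analysis.FluidPDE MeasureTheory Set Function Filter Topology Metric WithLp
open scoped InnerProductSpace RealInnerProductSpace Laplacian ContDiff

namespace Summit.NavierStokesRegularity.NavierStokesRegularity.Theorems

-- the problem directory repeats the summit name (`NavierStokesRegularity/NavierStokesRegularity`)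
set_option linter.dupNamespace false

/-- **The engine with the parabolic-boundary data on the radial momentum itself.** Standing class
`AxisymmetricL3Hyp`; `K = B̄(0,R) ∩ {r ≤ δ₁}`, `U = B(0,R) ∩ {r < δ₁}`. If `Φ = x₀u₀ + x₁u₁ ≥ −L` on the
lateral part `K ∖ U` for `t ∈ [0,T)` and on `K` at `t = 0`, and the cyclostrophic defect is `≥ −g(t)` at the
off-axis spatial critical points of `Φ(t,·)` in `U` with `ΔΦ ≥ 0` (`g ≥ 0` continuous on `[0,T)`,
`∫₀ᵗ g ≤ I`), then `Φ ≥ −(L + I)` on `K × [0,T)`. Proof as `radialMomentum_minPrinciple_engine`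
(`weak_max_principle_of_contDiffAt` for `w = −Φ − ∫₀ˢ g − L`). [new] -/
theorem radialMomentum_minPrinciple_engine_wall {ν T : ℝ} {u : ℝ → EuclideanSpace ℝ (Fin 3) → EuclideanSpace ℝ (Fin 3)} {p : ℝ → EuclideanSpace ℝ (Fin 3) → ℝ}
    (H : AxisymmetricL3Hyp ν T u p) {δ₁ R L I : ℝ}
    {g : ℝ → ℝ} (hgc : ContinuousOn g (Ico 0 T)) (hg0 : ∀ t ∈ Ico 0 T, 0 ≤ g t)
    (hgI : ∀ t ∈ Ico 0 T, ∫ s in (0:ℝ)..t, g s ≤ I)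
    (hfloor : ∀ t ∈ Ico 0 T, ∀ x ∈ ball (0 : EuclideanSpace ℝ (Fin 3)) R ∩ {x | cylRadius x < δ₁},
      cylRadius x ≠ 0 →
      fderiv ℝ (fun z : EuclideanSpace ℝ (Fin 3) => z 0 * u t z 0 + z 1 * u t z 1) x = 0 →
      0 ≤ (Δ (fun z : EuclideanSpace ℝ (Fin 3) => z 0 * u t z 0 + z 1 * u t z 1)) x →
      -g t ≤ (u t x 0) ^ 2 + (u t x 1) ^ 2
        - (x 0 * fderiv ℝ (p t) x (EuclideanSpace.single 0 1)
            + x 1 * fderiv ℝ (p t) x (EuclideanSpace.single 1 1)))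
    (hlat : ∀ t ∈ Ico 0 T, ∀ x ∈ (closedBall (0 : EuclideanSpace ℝ (Fin 3)) R ∩ {x | cylRadius x ≤ δ₁}) \
      (ball (0 : EuclideanSpace ℝ (Fin 3)) R ∩ {x | cylRadius x < δ₁}), -L ≤ x 0 * u t x 0 + x 1 * u t x 1)
    (hbot : ∀ x ∈ closedBall (0 : EuclideanSpace ℝ (Fin 3)) R ∩ {x | cylRadius x ≤ δ₁},
      -L ≤ x 0 * u 0 x 0 + x 1 * u 0 x 1) :
    ∀ t ∈ Ico 0 T, ∀ x ∈ closedBall (0 : EuclideanSpace ℝ (Fin 3)) R ∩ {x | cylRadius x ≤ δ₁},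
      -(L + I) ≤ x 0 * u t x 0 + x 1 * u t x 1 := by
  intro t ht x hx
  set K : Set (EuclideanSpace ℝ (Fin 3)) := closedBall (0 : EuclideanSpace ℝ (Fin 3)) R ∩ {x | cylRadius x ≤ δ₁} with hK_def
  set U : Set (EuclideanSpace ℝ (Fin 3)) := ball (0 : EuclideanSpace ℝ (Fin 3)) R ∩ {x | cylRadius x < δ₁} with hU_def
  set G : ℝ → ℝ := fun s => ∫ τ in (0:ℝ)..s, g τ with hG_def
  set w : ℝ → EuclideanSpace ℝ (Fin 3) → ℝ := fun s y => -(y 0 * u s y 0 + y 1 * u s y 1) - G s - L with hw_def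
  set wt : ℝ → EuclideanSpace ℝ (Fin 3) → ℝ := fun s y =>
    -(y 0 * timeDerivWithin (Ico 0 T) u s y 0 + y 1 * timeDerivWithin (Ico 0 T) u s y 1) - g s
    with hwt_def
  have hν := H.viscosity_pos
  have hsm := H.classical.smooth_velocity
  have htT : Icc 0 t ⊆ Ico 0 T := fun s hs => ⟨hs.1, hs.2.trans_lt ht.2⟩
  -- the time integral of the floor
  have hG0 : G 0 = 0 := intervalIntegral.integral_same
  have hGnn : ∀ s ∈ Icc 0 t, 0 ≤ G s := fun s hs =>
    intervalIntegral.integral_nonneg hs.1 fun τ hτ => hg0 τ ⟨hτ.1, hτ.2.trans_lt (hs.2.trans_lt ht.2)⟩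
  -- the sets
  have hK : IsCompact K :=
    (isCompact_closedBall _ _).inter_right (isClosed_le continuous_cylRadius continuous_const)
  have hU : IsOpen U := isOpen_ball.inter (isOpen_lt continuous_cylRadius continuous_const)
  have hUK : U ⊆ K := fun y hy =>
    ⟨ball_subset_closedBall hy.1, (le_of_lt (hy.2 : cylRadius y < δ₁) : cylRadius y ≤ δ₁)⟩
  -- joint continuity of `w` on `[0,t] × K`
  have hc : ContinuousOn (uncurry w) (Icc 0 t ×ˢ K) := by
    have hu : ContinuousOn (uncurry u) (Icc 0 t ×ˢ K) :=
      hsm.continuousOn.mono (prod_mono htT (subset_univ _))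
    have h0 : ContinuousOn (fun q : ℝ × EuclideanSpace ℝ (Fin 3) => uncurry u q 0) (Icc 0 t ×ˢ K) :=
      (EuclideanSpace.proj (0 : Fin 3)).continuous.comp_continuousOn hu
    have h1 : ContinuousOn (fun q : ℝ × EuclideanSpace ℝ (Fin 3) => uncurry u q 1) (Icc 0 t ×ˢ K) :=
      (EuclideanSpace.proj (1 : Fin 3)).continuous.comp_continuousOn hu
    have hy0 : Continuous (fun q : ℝ × EuclideanSpace ℝ (Fin 3) => q.2 0) := (EuclideanSpace.proj (0 : Fin 3)).continuous.comp continuous_snd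
    have hy1 : Continuous (fun q : ℝ × EuclideanSpace ℝ (Fin 3) => q.2 1) := (EuclideanSpace.proj (1 : Fin 3)).continuous.comp continuous_snd
    have hGc : ContinuousOn G (Icc 0 t) := by
      have hint : IntegrableOn g (uIcc 0 t) := by
        rw [uIcc_of_le ht.1]
        exact (hgc.mono htT).integrableOn_compact isCompact_Icc
      have := intervalIntegral.continuousOn_primitive_interval (μ := volume) hint
      rwa [uIcc_of_le ht.1] at this
    have hGc' : ContinuousOn (fun q : ℝ × EuclideanSpace ℝ (Fin 3) => G q.1) (Icc 0 t ×ˢ K) :=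
      hGc.comp continuous_fst.continuousOn fun q hq => hq.1
    have e : uncurry w = fun q : ℝ × EuclideanSpace ℝ (Fin 3) =>
        -(q.2 0 * uncurry u q 0 + q.2 1 * uncurry u q 1) - G q.1 - L := by
      funext q
      rfl
    rw [e]
    exact ((((hy0.continuousOn.mul h0).add (hy1.continuousOn.mul h1)).neg.sub hGc').sub
      continuousOn_const)
  -- slice regularity
  have h2 : ∀ s ∈ Ioc 0 t, ∀ y ∈ U, ContDiffAt ℝ 2 (w s) y := by
    intro s hs y _
    have hs' : s ∈ Ico 0 T := ⟨hs.1.le, hs.2.trans_lt ht.2⟩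
    have hU2 : ContDiff ℝ 2 (u s) := (H.classical.contDiff_velocity hs').of_le (by norm_cast)
    exact (((contDiff_radialMomentum hU2).neg.sub contDiff_const).sub contDiff_const).contDiffAt
  -- the left time derivative
  have hderiv : ∀ s ∈ Ioc 0 t, ∀ y ∈ U,
      HasDerivWithinAt (fun τ => w τ y) (wt s y) (Icc 0 s) s := by
    intro s hs y _
    have hs' : s ∈ Ico 0 T := ⟨hs.1.le, hs.2.trans_lt ht.2⟩
    have hsT : s ∈ Ioo 0 T := ⟨hs.1, hs.2.trans_lt ht.2⟩
    have hΦ := (hasDerivWithinAt_radialMomentum hsm hs' y).mono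
      (show Icc 0 s ⊆ Ico 0 T from fun τ hτ => ⟨hτ.1, hτ.2.trans_lt hsT.2⟩)
    have hgs : ContinuousAt g s :=
      (hgc.mono Ioo_subset_Ico_self).continuousAt (isOpen_Ioo.mem_nhds hsT)
    have hmeas : StronglyMeasurableAtFilter g (𝓝 s) volume :=
      (hgc.mono Ioo_subset_Ico_self).stronglyMeasurableAtFilter isOpen_Ioo _ hsT
    have hii : IntervalIntegrable g volume 0 s := by
      refine (hgc.mono ?_).intervalIntegrable
      rw [uIcc_of_le hs.1.le]
      exact fun τ hτ => ⟨hτ.1, hτ.2.trans_lt hsT.2⟩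
    have hG : HasDerivAt G (g s) s := intervalIntegral.integral_hasDerivAt_right hii hmeas hgs
    exact (hΦ.neg.sub hG.hasDerivWithinAt).sub_const L
  -- the sub-solution property at interior critical points
  have hsub : ∀ s ∈ Ioc 0 t, ∀ y ∈ U, fderiv ℝ (w s) y = 0 → (Δ (w s)) y ≤ 0 → wt s y ≤ 0 := by
    intro s hs y hy hgrad hlap
    have hs' : s ∈ Ico 0 T := ⟨hs.1.le, hs.2.trans_lt ht.2⟩
    have hU2 : ContDiff ℝ 2 (u s) := (H.classical.contDiff_velocity hs').of_le (by norm_cast)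
    have hΦ2 : ContDiff ℝ 2 (fun z : EuclideanSpace ℝ (Fin 3) => z 0 * u s z 0 + z 1 * u s z 1) :=
      contDiff_radialMomentum hU2
    have hw_eq : w s = fun z => -(z 0 * u s z 0 + z 1 * u s z 1) - (G s + L) := by
      funext z
      simp only [hw_def]
      ring
    have hgradΦ : fderiv ℝ (fun z : EuclideanSpace ℝ (Fin 3) => z 0 * u s z 0 + z 1 * u s z 1) y = 0 := by
      have e : fderiv ℝ (w s) y = -fderiv ℝ (fun z : EuclideanSpace ℝ (Fin 3) => z 0 * u s z 0 + z 1 * u s z 1) y := by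
        rw [hw_eq, fderiv_sub_const, fderiv_fun_neg]
      rw [e] at hgrad
      exact neg_eq_zero.1 hgrad
    have hlapΦ : 0 ≤ (Δ (fun z : EuclideanSpace ℝ (Fin 3) => z 0 * u s z 0 + z 1 * u s z 1)) y := by
      have e : (Δ (w s)) y = -(Δ (fun z : EuclideanSpace ℝ (Fin 3) => z 0 * u s z 0 + z 1 * u s z 1)) y := by
        rw [hw_eq]
        exact laplacian_neg_sub_const hΦ2 _ y
      rw [e] at hlap
      linarith
    have hg0s := hg0 s hs'
    by_cases hax : cylRadius y = 0
    · obtain ⟨h0, h1⟩ := (cylRadius_eq_zero_iff y).1 hax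
      simp only [hwt_def, h0, h1, zero_mul, add_zero, neg_zero, zero_sub]
      linarith
    · have hUD : UniqueDiffWithinAt ℝ (Ico 0 T) s := uniqueDiffOn_Ico 0 T s hs'
      have hcrit := timeDerivWithin_radialMomentum_of_critical H.classical hs' hUD
        (H.axisymmetric s hs') hax hgradΦ
      have e := timeDerivWithin_radialMomentum hsm hs' hUD y
      have hfl := hfloor s hs' y hy hax hgradΦ hlapΦ
      have hνΔ : 0 ≤ ν * (Δ (fun z : EuclideanSpace ℝ (Fin 3) => z 0 * u s z 0 + z 1 * u s z 1)) y :=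
        mul_nonneg hν.le hlapΦ
      simp only [hwt_def]
      rw [← e, hcrit]
      simp only [Pi.zero_apply, PiLp.zero_apply, mul_zero, add_zero]
      linarith
  -- the parabolic boundary
  have hbot' : ∀ y ∈ K, w 0 y ≤ 0 := by
    intro y hy
    have h := hbot y hy
    simp only [hw_def, hG0]
    linarith
  have hlat' : ∀ s ∈ Icc 0 t, ∀ y ∈ K \ U, w s y ≤ 0 := by
    intro s hs y hy
    have h := hlat s (htT hs) y hy
    have hG := hGnn s hs
    simp only [hw_def]
    linarith
  -- the weak maximum principle
  have key := weak_max_principle_of_contDiffAt hK hU hUK hc h2 hderiv hsub hbot' hlat' t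
    ⟨ht.1, le_rfl⟩ x hx
  have hGI : G t ≤ I := hgI t ht
  simp only [hw_def] at key
  linarith


/-- **One-wall inflow + pressure-excess criterion (axisymmetric, any swirl).** In the standing class of
the crux `AxisymSwirlRegular` (classical on `[0,T)`, Leray–Hopf, bounded on sub-slabs, axisymmetric
slices, rapidly decaying datum) suppose that for some `δ₁ > 0`, `R`, `L` and a continuous `g ≥ 0` on
`[0,T)` with `∫₀ᵗ g ≤ I`:
(i) the radial momentum `Φ = x₀u₀ + x₁u₁ = r u_r` is `≥ −L` on `{r ≤ δ₁} ∩ ({r = δ₁} ∪ {|x| ≥ R})` for all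
`t ∈ [0,T)` (ONE cylinder wall and the far region) and on `{r ≤ δ₁}` at `t = 0`;
(ii) at every off-axis spatial critical point of `Φ(t,·)` in `B(0,R) ∩ {r < δ₁}` with `ΔΦ ≥ 0` (the
strongest-inflow points) the cyclostrophic defect is `≥ −g(t)`, i.e. `r∂ᵣp ≤ u_r² + u_θ² + g(t)` there;
(iii) the budget `L + I < 2ν`.
Then the solution extends smoothly past `T`. Proof: `radialMomentum_minPrinciple_engine_wall` gives
`r u_r ≥ −(L + I)` on the tube, i.e. the hypothesis of the one-sided radial criterion with the constant
`C = (L + I)/ν < 2`, which is the tree theorem `ScenarioCensus.LogGate.oneSidedRadialCriterion_of_lt_two`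
(Wei 2016 via the log gate; print: Pan 2017 `C = 1`, Zujin Zhang 2018 `1 < C < 2`). A blow-up at `T` thus
forces, for EVERY wall `r = δ₁`: inflow `r u_r < −L` somewhere on the wall / far away / initially, or a
cumulative pressure-pull excess `∫ (r∂ᵣp − u_r² − u_θ²)⁺ dt ≥ 2ν − L` at the strongest-inflow points. [new] -/
theorem hasSmoothExtensionPast_of_wallInflow_of_criticalDefectFloor {ν T : ℝ}
    {u : ℝ → EuclideanSpace ℝ (Fin 3) → EuclideanSpace ℝ (Fin 3)} {p : ℝ → EuclideanSpace ℝ (Fin 3) → ℝ}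
    (H : AxisymmetricL3Hyp ν T u p) (hdec : HasRapidSpatialDecay (u 0)) {δ₁ R L I : ℝ} (hδ₁ : 0 < δ₁)
    {g : ℝ → ℝ} (hgc : ContinuousOn g (Ico 0 T)) (hg0 : ∀ t ∈ Ico 0 T, 0 ≤ g t)
    (hgI : ∀ t ∈ Ico 0 T, ∫ s in (0:ℝ)..t, g s ≤ I)
    (hwall : ∀ t ∈ Ico 0 T, ∀ x, cylRadius x ≤ δ₁ → (δ₁ ≤ cylRadius x ∨ R ≤ ‖x‖) →
      -L ≤ x 0 * u t x 0 + x 1 * u t x 1)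
    (hbot : ∀ x, cylRadius x ≤ δ₁ → -L ≤ x 0 * u 0 x 0 + x 1 * u 0 x 1)
    (hfloor : ∀ t ∈ Ico 0 T, ∀ x ∈ ball (0 : EuclideanSpace ℝ (Fin 3)) R ∩ {x | cylRadius x < δ₁},
      cylRadius x ≠ 0 →
      fderiv ℝ (fun z : EuclideanSpace ℝ (Fin 3) => z 0 * u t z 0 + z 1 * u t z 1) x = 0 →
      0 ≤ (Δ (fun z : EuclideanSpace ℝ (Fin 3) => z 0 * u t z 0 + z 1 * u t z 1)) x →
      -g t ≤ (u t x 0) ^ 2 + (u t x 1) ^ 2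
        - (x 0 * fderiv ℝ (p t) x (EuclideanSpace.single 0 1)
            + x 1 * fderiv ℝ (p t) x (EuclideanSpace.single 1 1)))
    (hbudget : L + I < 2 * ν) :
    HasSmoothExtensionPast ν 0 u T := by
  have hν := H.viscosity_pos
  have hT := H.time_pos
  have hI0 : 0 ≤ I := by
    have h := hgI 0 ⟨le_rfl, hT⟩
    rwa [intervalIntegral.integral_same] at h
  -- the engine on the truncated tube
  have key := radialMomentum_minPrinciple_engine_wall H hgc hg0 hgI hfloor
    (fun t ht x hx => by
      have hxK := hx.1
      have hr : cylRadius x ≤ δ₁ := hxK.2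
      refine hwall t ht x hr ?_
      by_cases hxR : R ≤ ‖x‖
      · exact Or.inr hxR
      · have hxb : x ∈ ball (0 : EuclideanSpace ℝ (Fin 3)) R := mem_ball_zero_iff.2 (lt_of_not_ge hxR)
        left
        by_contra hlt
        exact hx.2 ⟨hxb, lt_of_not_ge hlt⟩)
    (fun x hx => hbot x hx.2)
  -- the one-sided radial criterion with the subcritical constant `(L + I)/ν < 2`
  have hC : (L + I) / ν < 2 := by
    rw [div_lt_iff₀ hν]
    linarith
  refine ScenarioCensus.LogGate.oneSidedRadialCriterion_of_lt_two (C := (L + I) / ν) hν hT hC hδ₁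
    H.classical H.lerayHopf H.bounded_subslab H.axisymmetric hdec fun t ht x hx => ?_
  have hCν : (L + I) / ν * ν = L + I := div_mul_cancel₀ _ hν.ne'
  rw [hCν]
  by_cases hxR : ‖x‖ ≤ R
  · exact key t ht x ⟨mem_closedBall_zero_iff.2 hxR, (le_of_lt hx : cylRadius x ≤ δ₁)⟩
  · have h := hwall t ht x (le_of_lt hx) (Or.inr (le_of_not_ge hxR))
    linarith

end Summit.NavierStokesRegularity.NavierStokesRegularity.Theorems

end
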